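import Summits.QuantumFields.YangMills.Theorems.AllWindowsColdBoxBoxHighLineK4PrimeRowR2Prelims

/-!
# K4′(b) ROW R2 — the `Q`-slots of `κ₄,₀^{μ_{D′}}(c_x, c_y; P, P)`: `κ₄(Q_x, c_y; P) + κ₄(L_x, Q_y; P)` by Hölder (4,4,4,4)
# (LEAD ym-line-sfw-p2 g78's `ym-idea-1/g78-K4PRIME-TERM-TABLE.md` §2 row R2, offered §4 to this seat; planner ym-idea-2 g18 endorsement 2026-08-30T00:46:21Z;
#  `Cruxes/BoxWindowHighSU2213/ASSEMBLY-U5.md` §3 Steps D–E, hK4′ of `landauThirdOrder_of_sizes`; LINE-20 U5 ⟨stmt-QuantumFields-24336⟩)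

Width seat `ym-line-sfw-p2-w5` (prover-ym-line-sfw-p2-w5-g24-0).  Letters = R1 ✓`EdgeChartGaussian.abs_tiltCum4_muSet_cubicPair_le`: `P := β·Σ_{p∈PT} tripleForm (Tc p) (plaqVar p ·)`
(`|Tc| ≤ B`), `L_z := linCurvSq H (plaq12At z)`, `Q_z := chartPlaqCost H z 1 2 − L_z`, `μ_{D′} := (volume.restrict D′).withDensity (ofReal ∘ gaussWeight β H)` for a measurable
`D′ ⊆ smallField H s`, mass defect `E₀[1 − 1_{D′}] ≤ τ ≤ 1/2`.  Since `κ₄,₀(X, Y; P, P) = CROSS(X, Y; P, P)` at `t = 0` (tilt letter immaterial), fcl-p3 g27's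
✓`GaussRestrict.abs_cross_muSet_zero_le_gaussAvg` (Hölder (4,4,4,4) over `μ_{D′}`, re-centring at constants, `E ≤ 2E₀[1_{D′}·]`) gives — NO parity needed —

  `|κ₄(X,Y;P)| ≤ 128·(E₀[1_{D′}(X−a₁)⁴])^{1/4}·(E₀[1_{D′}(Y−a₂)⁴])^{1/4}·(E₀[1_{D′}P⁴])^{1/2}`   (`r2_collapse`),

and the four Gaussian sizes are tree theorems: `E₀[1_{D′}Q⁴] ≤ 8C_o s⁶/β³ + 8C₇⁴s¹⁶` (`Q = c^{odd} + evenRem`: ✓`TiltSup.gaussAvg_sfInd_odd_pow_four_le` + ✓7a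
`TiltSup.abs_chartPlaqCost_even_rem_le_of wilsonPlaquetteTaylor`), `E₀[1_{D′}(c_y − m_y)⁴] ≤ C_P(L⁴/β⁴ + s⁶/β³)` (✓`gaussAvg_sfInd_mul_chartPlaqCost_sub_mean_pow_le`),
`E₀[(L_x − m_x)⁴] ≤ 81(C_vL²/β²)²` and `E₀[P⁴] ≤ 729(C_TB²H⁴L³/β)²` (Bonami–Nelson ✓`gaussAvg_pow_even_le_of_polyCert_of_le` over ✓`gaussAvg_centred_linCurvSq_sq_le` /
✓`tripleBond_gaussAvg_le`).  Results:

* (✓`…K4PrimeRowR2Prelims`: `r2_collapse`, `tiltCum4_zero_eq_cross`, the four size lemmas); here `sqrt_sqrt_le_of_le_pow_four`;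
* ★★ `abs_tiltCum4_muSet_rowR2_le` — `|κ₄(Q_x, c_y; P)| + |κ₄(L_x, Q_y; P)| ≤ C·B²·H⁴·(1+log H)³/β · (s⁶/β³ + s¹⁶)^{1/4} · ((1+log H)⁴/β⁴ + s⁶/β³)^{1/4}`
  (`H ≥ 1`, `β ≥ 1`, `0 ≤ s ≤ 1`; fourth roots as `√√`);
* ★★ `abs_tiltCum4_muSet_rowR2_le_rpow` — β-LETTERS at `s = β^{−1/2+κ₃}`, `κ₃ ≤ 1/5` (✓ at the exponent point of record `κ₃ = 1/8 − θ/4`), EVERY `β ≥ 1`, `H ≥ 1`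
  (no window, no threshold): `R2 ≤ C·B²·H⁴·(1+log H)⁴·β^(−7/2 + (3/2)κ₃)` = LEAD's size column (rel `H¹²β^{−3/2+1.5κ₃}`; no `√τ` term, q-demand none).

Tree only; no definitions; standard axioms.  HONEST LABEL: U5 prep, helper-grade (one row of hK4′); U5 ⟨24336⟩ UNSTAFFED/OPEN, ⟨24004⟩ OPEN; route AllWindowsColdBox DRAFT;
no crux, rung or summit is proved; **the Yang–Mills mass gap is NOT proved by this file; no summit is proved by a line.**
-/

set_option autoImplicit false

noncomputable section

open MeasureTheory Set Finset
open Literature.Probability.LatticeModels (Site)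
open Literature.MathematicalPhysics.QuantumLattice (ZdPlaquette plaquettesTouching)
open Literature.MathematicalPhysics.QuantumFieldTheory.AxialGauge (boxEdges)
open Summit.QuantumFields.YangMills.Theorems.WeakCouplingRates (plaq12At)

namespace Summit.QuantumFields.YangMills.Theorems.AllWindowsColdBoxBoxHighLine

namespace GaussNormalForm

open EdgeChartGaussian (polyCert_const polyCert_sub polyCert_pow polyCert_linCurvSq polyCert_tripleFormSum integrable_polyCert_mul_gaussWeight
  measurable_of_polyCert gaussAvg_mono_of_nonneg gaussAvg_nonneg)
open LaplaceSandwich (flatten)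

variable {H : ℕ} {β : ℝ}

/-! ## §3 Row R2 -/

/-- ★★ **K4′(b) ROW R2**: for `H ≥ 1`, `β ≥ 1`, `|Tc| ≤ B`, `0 ≤ s ≤ 1`, a measurable `D′ ⊆ smallField H s` with `E₀[1 − 1_{D′}] ≤ τ ≤ 1/2`, all `x y`:
`|κ₄(Q_x, c_y; P)| + |κ₄(L_x, Q_y; P)| ≤ C·B²·H⁴·(1+log H)³/β · (s⁶/β³ + s¹⁶)^{1/4} · ((1+log H)⁴/β⁴ + s⁶/β³)^{1/4}` over `μ_{D′}`. -/
theorem abs_tiltCum4_muSet_rowR2_le : ∃ C : ℝ, 0 ≤ C ∧ ∀ H : ℕ, 1 ≤ H → ∀ β : ℝ, 1 ≤ β → ∀ B : ℝ,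
    ∀ Tc : ZdPlaquette 4 → Fin 4 → Fin 4 → Fin 4 → ℝ, (∀ p i j k, |Tc p i j k| ≤ B) →
    ∀ s : ℝ, 0 ≤ s → s ≤ 1 → ∀ D : Set (LandauFree H → E3), MeasurableSet D → D ⊆ smallField H s →
    ∀ τ : ℝ, gaussAvg β H (fun a => 1 - D.indicator (fun _ => (1 : ℝ)) a) ≤ τ → τ ≤ 1 / 2 → ∀ x y : Site 4,
    |Tilt.tiltCum4 ((((volume : Measure (LandauFree H → E3)).restrict D).withDensity fun a => ENNReal.ofReal (gaussWeight β H a)))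
        (fun a => β * ∑ p ∈ plaquettesTouching (boxEdges 4 (2 * H + 1)), tripleForm (Tc p) (plaqVar H p.1 p.2.1.1 p.2.1.2 a)) 0
        (fun a => chartPlaqCost H x 1 2 a - linCurvSq H (plaq12At x) a) (chartPlaqCost H y 1 2)| +
    |Tilt.tiltCum4 ((((volume : Measure (LandauFree H → E3)).restrict D).withDensity fun a => ENNReal.ofReal (gaussWeight β H a)))
        (fun a => β * ∑ p ∈ plaquettesTouching (boxEdges 4 (2 * H + 1)), tripleForm (Tc p) (plaqVar H p.1 p.2.1.1 p.2.1.2 a)) 0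
        (linCurvSq H (plaq12At x)) (fun a => chartPlaqCost H y 1 2 a - linCurvSq H (plaq12At y) a)| ≤
      C * B ^ 2 * (H : ℝ) ^ 4 * (1 + Real.log H) ^ 3 / β *
        (Real.sqrt (Real.sqrt (s ^ 6 / β ^ 3 + s ^ 16)) * Real.sqrt (Real.sqrt ((1 + Real.log H) ^ 4 / β ^ 4 + s ^ 6 / β ^ 3))) := by
  obtain ⟨CQ, hCQ0, hQ4⟩ := gaussAvg_indicator_mul_Q_pow_four_le
  obtain ⟨CY, hCY0, hY4⟩ := gaussAvg_indicator_mul_chartPlaqCost_sub_mean_pow_four_le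
  obtain ⟨CL, hCL0, hL4⟩ := gaussAvg_indicator_mul_linCurvSq_sub_mean_pow_four_le
  obtain ⟨CP, hCP0, hP4⟩ := gaussAvg_indicator_mul_tripleFormSum_pow_four_le
  refine ⟨256 * Real.sqrt (Real.sqrt CQ) * Real.sqrt (Real.sqrt (CY + CL)) * Real.sqrt CP, by positivity,
    fun H hH β hβ B Tc hT s hs0 hs1 D hDm hDs τ hτ hτ2 x y => ?_⟩
  classical
  have hβ0 : 0 < β := lt_of_lt_of_le one_pos hβ
  have hH1 : (1 : ℝ) ≤ H := by exact_mod_cast hH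
  have hL1 : 1 ≤ 1 + Real.log (H : ℝ) := by have := Real.log_nonneg hH1; linarith
  have hL0 : 0 ≤ 1 + Real.log (H : ℝ) := zero_le_one.trans hL1
  have hB0 : 0 ≤ B := (abs_nonneg _).trans (hT (((0 : Site 4), ⟨(0, 1), by decide⟩) : ZdPlaquette 4) 0 0 0)
  set PT := plaquettesTouching (boxEdges 4 (2 * H + 1)) with hPT
  set μD : Measure (LandauFree H → E3) := (((volume : Measure (LandauFree H → E3)).restrict D).withDensity
    fun a => ENNReal.ofReal (gaussWeight β H a)) with hμD
  set P : (LandauFree H → E3) → ℝ := fun a => β * ∑ p ∈ PT, tripleForm (Tc p) (plaqVar H p.1 p.2.1.1 p.2.1.2 a) with hPdef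
  set Qx : (LandauFree H → E3) → ℝ := fun a => chartPlaqCost H x 1 2 a - linCurvSq H (plaq12At x) a with hQx
  set Qy : (LandauFree H → E3) → ℝ := fun a => chartPlaqCost H y 1 2 a - linCurvSq H (plaq12At y) a with hQy
  -- measurability
  have hcP := polyCert_tripleFormSum H β PT Tc hT
  have mP : Measurable P := measurable_of_polyCert hcP
  have mQx : Measurable Qx := (EdgeChartGaussian.measurable_chartPlaqCost H x 1 2).sub (EdgeChartGaussian.measurable_linCurvSq H _)
  have mQy : Measurable Qy := (EdgeChartGaussian.measurable_chartPlaqCost H y 1 2).sub (EdgeChartGaussian.measurable_linCurvSq H _)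
  have mY : Measurable (chartPlaqCost H y 1 2) := EdgeChartGaussian.measurable_chartPlaqCost H y 1 2
  have mL : Measurable (linCurvSq H (plaq12At x)) := EdgeChartGaussian.measurable_linCurvSq H _
  -- one common bound on `D`
  obtain ⟨BD, hBD⟩ : ∃ b : ℝ, b = 100 + β * PT.card * (6 * B * (4 * s) ^ 3) := ⟨_, rfl⟩
  have hBD2 : 0 ≤ β * PT.card * (6 * B * (4 * s) ^ 3) := by positivity
  have hBD0 : 0 ≤ BD := by rw [hBD]; positivity
  have bQ : ∀ z : Site 4, ∀ a ∈ D, |chartPlaqCost H z 1 2 a - linCurvSq H (plaq12At z) a| ≤ BD := by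
    intro z a ha
    have h := TiltSup.abs_chartPlaqCost_sub_linCurvSq_le hs0 hs1 (hDs ha) z 1 2
    have h3 : s ^ 3 ≤ 1 := pow_le_one₀ hs0 hs1
    rw [hBD]; exact h.trans (by nlinarith)
  have bQx : ∀ a ∈ D, |Qx a| ≤ BD := bQ x
  have bQy : ∀ a ∈ D, |Qy a| ≤ BD := bQ y
  have bY : ∀ a ∈ D, |chartPlaqCost H y 1 2 a| ≤ BD := fun a _ =>
    (TiltSup.abs_chartPlaqCost_le_four (H := H) y 1 2 a).trans (by rw [hBD]; linarith)
  have bL : ∀ a ∈ D, |linCurvSq H (plaq12At x) a| ≤ BD := by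
    intro a ha
    have h1 := TiltSup.linCurvSq_le hs0 (hDs ha) x 1 2
    have h0 : 0 ≤ linCurvSq H (plaq12At x) a := Finset.sum_nonneg fun c _ => sq_nonneg _
    have h2 : s ^ 2 ≤ 1 := pow_le_one₀ hs0 hs1
    rw [abs_of_nonneg h0, hBD]; exact h1.trans (by nlinarith)
  have bP : ∀ a ∈ D, |P a| ≤ BD := by
    intro a ha
    rw [hPdef, abs_mul, abs_of_pos hβ0]
    have hterm : ∀ p ∈ PT, |tripleForm (Tc p) (plaqVar H p.1 p.2.1.1 p.2.1.2 a)| ≤ 6 * B * (4 * s) ^ 3 := by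
      intro p _
      refine (EdgeChartGaussian.abs_tripleForm_le (Tc p) (hT p) _).trans ?_
      exact mul_le_mul_of_nonneg_left (pow_le_pow_left₀ (Finset.sum_nonneg fun i _ => norm_nonneg _)
        (TiltSup.sum_norm_plaqVar_le hs0 (hDs ha) p.1 p.2.1.1 p.2.1.2) 3) (by positivity)
    have hsum : |∑ p ∈ PT, tripleForm (Tc p) (plaqVar H p.1 p.2.1.1 p.2.1.2 a)| ≤ PT.card * (6 * B * (4 * s) ^ 3) := by
      refine (Finset.abs_sum_le_sum_abs _ _).trans ((Finset.sum_le_sum hterm).trans (le_of_eq ?_))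
      rw [Finset.sum_const, nsmul_eq_mul]
    calc β * |∑ p ∈ PT, tripleForm (Tc p) (plaqVar H p.1 p.2.1.1 p.2.1.2 a)| ≤ β * (PT.card * (6 * B * (4 * s) ^ 3)) :=
          mul_le_mul_of_nonneg_left hsum hβ0.le
      _ ≤ BD := by rw [hBD]; linarith
  -- the two CROSS bounds (fcl-p3 g27), read as bounds on `κ₄(·,·;P)`
  have hc1 := GaussRestrict.abs_cross_muSet_zero_le_gaussAvg hβ0 hDm hτ hτ2 hBD0 mQx mY mP mP bQx bY bP bP
    0 (gaussAvg β H (linCurvSq H (plaq12At y))) 0 0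
  have hc2 := GaussRestrict.abs_cross_muSet_zero_le_gaussAvg hβ0 hDm hτ hτ2 hBD0 mL mQy mP mP bL bQy bP bP
    (gaussAvg β H (linCurvSq H (plaq12At x))) 0 0 0
  dsimp only at hc1 hc2
  rw [← hμD] at hc1 hc2
  rw [← tiltCum4_zero_eq_cross μD P Qx (chartPlaqCost H y 1 2)] at hc1
  rw [← tiltCum4_zero_eq_cross μD P (linCurvSq H (plaq12At x)) Qy] at hc2
  -- the four sizes
  obtain ⟨SQ, hSQ⟩ : ∃ t : ℝ, t = s ^ 6 / β ^ 3 + s ^ 16 := ⟨_, rfl⟩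
  obtain ⟨W, hW⟩ : ∃ t : ℝ, t = (1 + Real.log (H : ℝ)) ^ 4 / β ^ 4 + s ^ 6 / β ^ 3 := ⟨_, rfl⟩
  obtain ⟨Z, hZ⟩ : ∃ t : ℝ, t = B ^ 2 * (H : ℝ) ^ 4 * (1 + Real.log (H : ℝ)) ^ 3 / β := ⟨_, rfl⟩
  have hSQ0 : 0 ≤ SQ := by rw [hSQ]; positivity
  have hW0 : 0 ≤ W := by rw [hW]; positivity
  have hZ0 : 0 ≤ Z := by rw [hZ]; positivity
  have aQx : gaussAvg β H (fun a => D.indicator (fun _ => (1 : ℝ)) a * (Qx a - 0) ^ 4) ≤ CQ * SQ := by rw [hSQ]; exact hQ4 H hH β hβ s hs0 hs1 D hDs x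
  have aQy : gaussAvg β H (fun a => D.indicator (fun _ => (1 : ℝ)) a * (Qy a - 0) ^ 4) ≤ CQ * SQ := by rw [hSQ]; exact hQ4 H hH β hβ s hs0 hs1 D hDs y
  have aY : gaussAvg β H (fun a => D.indicator (fun _ => (1 : ℝ)) a * (chartPlaqCost H y 1 2 a - gaussAvg β H (linCurvSq H (plaq12At y))) ^ 4) ≤
      (CY + CL) * W := by
    rw [hW]; exact (hY4 H hH β hβ s hs0 hs1 D hDs y).trans (mul_le_mul_of_nonneg_right (by linarith) (by positivity))
  have aL : gaussAvg β H (fun a => D.indicator (fun _ => (1 : ℝ)) a * (linCurvSq H (plaq12At x) a - gaussAvg β H (linCurvSq H (plaq12At x))) ^ 4) ≤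
      (CY + CL) * W := by
    refine (hL4 H hH β hβ0 D x).trans ?_
    rw [hW]
    have h1 : (1 + Real.log (H : ℝ)) ^ 4 / β ^ 4 ≤ (1 + Real.log (H : ℝ)) ^ 4 / β ^ 4 + s ^ 6 / β ^ 3 := le_add_of_nonneg_right (by positivity)
    nlinarith [mul_le_mul_of_nonneg_left h1 hCL0, mul_nonneg hCY0 (show (0:ℝ) ≤ (1 + Real.log (H : ℝ)) ^ 4 / β ^ 4 + s ^ 6 / β ^ 3 by positivity)]
  have aP : gaussAvg β H (fun a => D.indicator (fun _ => (1 : ℝ)) a * (P a - 0) ^ 4) ≤ CP * Z ^ 2 := by rw [hZ]; exact hP4 H hH β hβ0 B Tc hT D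
  have nP : 0 ≤ gaussAvg β H (fun a => D.indicator (fun _ => (1 : ℝ)) a * (P a - 0) ^ 4) :=
    gaussAvg_nonneg H hβ0 fun a => mul_nonneg (GaussRestrict.indicator_one_nonneg_le_one D a).1 (by positivity)
  -- collapse
  have k1 := hc1.trans (r2_collapse aQx aY nP aP)
  have k2 := hc2.trans (r2_collapse aL aQy nP aP)
  -- `√√` algebra
  have eQ : Real.sqrt (Real.sqrt (CQ * SQ)) = Real.sqrt (Real.sqrt CQ) * Real.sqrt (Real.sqrt SQ) := by
    rw [Real.sqrt_mul hCQ0, Real.sqrt_mul (Real.sqrt_nonneg _)]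
  have eW : Real.sqrt (Real.sqrt ((CY + CL) * W)) = Real.sqrt (Real.sqrt (CY + CL)) * Real.sqrt (Real.sqrt W) := by
    rw [Real.sqrt_mul (by positivity : (0 : ℝ) ≤ CY + CL), Real.sqrt_mul (Real.sqrt_nonneg _)]
  have eP : Real.sqrt (CP * Z ^ 2) = Real.sqrt CP * Z := by rw [Real.sqrt_mul hCP0, Real.sqrt_sq hZ0]
  rw [eQ, eW, eP] at k1 k2
  have hfin : 128 * (Real.sqrt (Real.sqrt CQ) * Real.sqrt (Real.sqrt SQ) * (Real.sqrt (Real.sqrt (CY + CL)) * Real.sqrt (Real.sqrt W)) * (Real.sqrt CP * Z)) +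
      128 * (Real.sqrt (Real.sqrt (CY + CL)) * Real.sqrt (Real.sqrt W) * (Real.sqrt (Real.sqrt CQ) * Real.sqrt (Real.sqrt SQ)) * (Real.sqrt CP * Z)) =
      256 * Real.sqrt (Real.sqrt CQ) * Real.sqrt (Real.sqrt (CY + CL)) * Real.sqrt CP * B ^ 2 * (H : ℝ) ^ 4 * (1 + Real.log H) ^ 3 / β *
        (Real.sqrt (Real.sqrt SQ) * Real.sqrt (Real.sqrt W)) := by
    rw [hZ]; ring
  rw [hSQ, hW] at hfin
  rw [hSQ] at k1 k2
  rw [hW] at k1 k2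
  linarith [k1, k2, hfin.le, hfin.ge]

/-! ## §4 Row R2 in β-letters -/

/-- `√√X ≤ Y` from `X ≤ Y⁴`, `0 ≤ Y`. -/
theorem sqrt_sqrt_le_of_le_pow_four {X Y : ℝ} (hY : 0 ≤ Y) (h : X ≤ Y ^ 4) : Real.sqrt (Real.sqrt X) ≤ Y := by
  have h1 : Real.sqrt X ≤ Y ^ 2 := by
    rw [show Y ^ 2 = Real.sqrt (Y ^ 4) by rw [show Y ^ 4 = (Y ^ 2) ^ 2 by ring, Real.sqrt_sq (sq_nonneg _)]]
    exact Real.sqrt_le_sqrt h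
  rw [show Y = Real.sqrt (Y ^ 2) by rw [Real.sqrt_sq hY]]
  exact Real.sqrt_le_sqrt h1

/-- ★★ **ROW R2 in β-letters**: at `s = β^{−1/2+κ₃}` with `κ₃ ≤ 1/5`, for EVERY `β ≥ 1`, `H ≥ 1` (no window, no threshold):
`|κ₄(Q_x, c_y; P)| + |κ₄(L_x, Q_y; P)| ≤ C·B²·H⁴·(1+log H)⁴·β^(−7/2 + (3/2)κ₃)` over `μ_{D′}` — LEAD's size column of R2 (rel `H¹²β^{−3/2+1.5κ₃}`; no `√τ` term). -/
theorem abs_tiltCum4_muSet_rowR2_le_rpow {κ₃ : ℝ} (hκ5 : κ₃ ≤ 1 / 5) : ∃ C : ℝ, 0 ≤ C ∧ ∀ H : ℕ, 1 ≤ H → ∀ β : ℝ, 1 ≤ β → ∀ B : ℝ,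
    ∀ Tc : ZdPlaquette 4 → Fin 4 → Fin 4 → Fin 4 → ℝ, (∀ p i j k, |Tc p i j k| ≤ B) →
    ∀ D : Set (LandauFree H → E3), MeasurableSet D → D ⊆ smallField H (β ^ (-1 / 2 + κ₃)) →
    ∀ τ : ℝ, gaussAvg β H (fun a => 1 - D.indicator (fun _ => (1 : ℝ)) a) ≤ τ → τ ≤ 1 / 2 → ∀ x y : Site 4,
    |Tilt.tiltCum4 ((((volume : Measure (LandauFree H → E3)).restrict D).withDensity fun a => ENNReal.ofReal (gaussWeight β H a)))
        (fun a => β * ∑ p ∈ plaquettesTouching (boxEdges 4 (2 * H + 1)), tripleForm (Tc p) (plaqVar H p.1 p.2.1.1 p.2.1.2 a)) 0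
        (fun a => chartPlaqCost H x 1 2 a - linCurvSq H (plaq12At x) a) (chartPlaqCost H y 1 2)| +
    |Tilt.tiltCum4 ((((volume : Measure (LandauFree H → E3)).restrict D).withDensity fun a => ENNReal.ofReal (gaussWeight β H a)))
        (fun a => β * ∑ p ∈ plaquettesTouching (boxEdges 4 (2 * H + 1)), tripleForm (Tc p) (plaqVar H p.1 p.2.1.1 p.2.1.2 a)) 0
        (linCurvSq H (plaq12At x)) (fun a => chartPlaqCost H y 1 2 a - linCurvSq H (plaq12At y) a)| ≤
      C * B ^ 2 * (H : ℝ) ^ 4 * (1 + Real.log H) ^ 4 * β ^ (-7 / 2 + 3 / 2 * κ₃) := by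
  obtain ⟨C, hC0, h⟩ := abs_tiltCum4_muSet_rowR2_le
  refine ⟨4 * C, by positivity, fun H hH β hβ B Tc hT D hDm hDs τ hτ hτ2 x y => ?_⟩
  have hβ0 : 0 < β := lt_of_lt_of_le one_pos hβ
  have hH1 : (1 : ℝ) ≤ H := by exact_mod_cast hH
  have hL1 : 1 ≤ 1 + Real.log (H : ℝ) := by have := Real.log_nonneg hH1; linarith
  have hB0 : 0 ≤ B := (abs_nonneg _).trans (hT (((0 : Site 4), ⟨(0, 1), by decide⟩) : ZdPlaquette 4) 0 0 0)
  set s : ℝ := β ^ (-1 / 2 + κ₃) with hs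
  have hs0 : 0 ≤ s := (Real.rpow_pos_of_pos hβ0 _).le
  have hs1 : s ≤ 1 := TiltSup.rpow_neg_half_add_le_one hβ (by linarith)
  have hh := h H hH β hβ B Tc hT s hs0 hs1 D hDm hDs τ hτ hτ2 x y
  -- `s⁶/β³ = β^{6κ₃−6}`, `s¹⁶ = β^{16κ₃−8} ≤ β^{6κ₃−6}`, `β^{6κ₃−6} ≤ β^{−4}`
  obtain ⟨ρ, hρ⟩ : ∃ r : ℝ, r = β ^ (-3 / 2 + 3 / 2 * κ₃) := ⟨_, rfl⟩
  have hρ0 : 0 ≤ ρ := by rw [hρ]; exact (Real.rpow_pos_of_pos hβ0 _).le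
  have hρ4 : ρ ^ 4 = β ^ (6 * κ₃ - 6) := by
    rw [hρ, ← Real.rpow_natCast, ← Real.rpow_mul hβ0.le]; norm_num; ring_nf
  have e6 : s ^ 6 / β ^ 3 = β ^ (6 * κ₃ - 6) := by
    rw [hs, ← Real.rpow_natCast (β ^ (-1 / 2 + κ₃)) 6, ← Real.rpow_mul hβ0.le, show (β ^ 3 : ℝ) = β ^ (3 : ℝ) by norm_cast,
      ← Real.rpow_sub hβ0]
    norm_num; ring_nf
  have e16 : s ^ 16 ≤ β ^ (6 * κ₃ - 6) := by
    rw [hs, ← Real.rpow_natCast (β ^ (-1 / 2 + κ₃)) 16, ← Real.rpow_mul hβ0.le]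
    exact Real.rpow_le_rpow_of_exponent_le hβ (by push_cast; linarith)
  have e4 : β ^ (6 * κ₃ - 6) ≤ (1 + Real.log (H : ℝ)) ^ 4 / β ^ 4 := by
    have h1 : β ^ (6 * κ₃ - 6) ≤ β ^ (-4 : ℝ) := Real.rpow_le_rpow_of_exponent_le hβ (by linarith)
    have h2 : β ^ (-4 : ℝ) = 1 / β ^ 4 := by rw [Real.rpow_neg hβ0.le, one_div]; norm_cast
    rw [h2] at h1
    refine h1.trans ?_
    rw [div_le_div_iff_of_pos_right (by positivity)]
    exact one_le_pow₀ hL1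
  have hQ : Real.sqrt (Real.sqrt (s ^ 6 / β ^ 3 + s ^ 16)) ≤ 2 * ρ := by
    refine sqrt_sqrt_le_of_le_pow_four (by positivity) ?_
    rw [mul_pow, hρ4, e6]; norm_num; linarith [e16, (Real.rpow_pos_of_pos hβ0 (6 * κ₃ - 6)).le]
  have hWb : Real.sqrt (Real.sqrt ((1 + Real.log (H : ℝ)) ^ 4 / β ^ 4 + s ^ 6 / β ^ 3)) ≤ 2 * ((1 + Real.log (H : ℝ)) / β) := by
    refine sqrt_sqrt_le_of_le_pow_four (by positivity) ?_
    rw [mul_pow, div_pow, e6]; norm_num; linarith [e4, show (0:ℝ) ≤ (1 + Real.log (H : ℝ)) ^ 4 / β ^ 4 by positivity]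
  have hprod := mul_le_mul hQ hWb (Real.sqrt_nonneg _) (by positivity)
  have hpre : 0 ≤ C * B ^ 2 * (H : ℝ) ^ 4 * (1 + Real.log H) ^ 3 / β := by positivity
  refine hh.trans ((mul_le_mul_of_nonneg_left hprod hpre).trans (le_of_eq ?_))
  -- `β^{−3/2+3/2κ₃} / β / β = β^{−7/2+3/2κ₃}`
  have eρ : ρ / β / β = β ^ (-7 / 2 + 3 / 2 * κ₃) := by
    rw [hρ, div_div, ← sq, show (β ^ 2 : ℝ) = β ^ (2 : ℝ) by norm_cast, ← Real.rpow_sub hβ0]; ring_nf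
  rw [← eρ]; ring


/-! ## §5 The same two bounds for `|κ₄(Q_x, c_y; P) + κ₄(L_x, Q_y; P)|` (the R2 term EXACTLY as it appears in LEAD g78's
✓`GaussRestrict.abs_tiltCum4_muSet_tiltU_le_rows`, i.e. the `hR2` slot of w4 g30's `tiltCum4_cutSet_size_of_rows`) -/

/-- ★★ **ROW R2, sum form**: `|κ₄(Q_x, c_y; P) + κ₄(L_x, Q_y; P)| ≤ C·B²·H⁴·(1+log H)³/β·(s⁶/β³ + s¹⁶)^{1/4}·((1+log H)⁴/β⁴ + s⁶/β³)^{1/4}`. -/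
theorem abs_tiltCum4_muSet_rowR2_sum_le : ∃ C : ℝ, 0 ≤ C ∧ ∀ H : ℕ, 1 ≤ H → ∀ β : ℝ, 1 ≤ β → ∀ B : ℝ,
    ∀ Tc : ZdPlaquette 4 → Fin 4 → Fin 4 → Fin 4 → ℝ, (∀ p i j k, |Tc p i j k| ≤ B) →
    ∀ s : ℝ, 0 ≤ s → s ≤ 1 → ∀ D : Set (LandauFree H → E3), MeasurableSet D → D ⊆ smallField H s →
    ∀ τ : ℝ, gaussAvg β H (fun a => 1 - D.indicator (fun _ => (1 : ℝ)) a) ≤ τ → τ ≤ 1 / 2 → ∀ x y : Site 4,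
    |Tilt.tiltCum4 ((((volume : Measure (LandauFree H → E3)).restrict D).withDensity fun a => ENNReal.ofReal (gaussWeight β H a)))
        (fun a => β * ∑ p ∈ plaquettesTouching (boxEdges 4 (2 * H + 1)), tripleForm (Tc p) (plaqVar H p.1 p.2.1.1 p.2.1.2 a)) 0
        (fun a => chartPlaqCost H x 1 2 a - linCurvSq H (plaq12At x) a) (chartPlaqCost H y 1 2) +
     Tilt.tiltCum4 ((((volume : Measure (LandauFree H → E3)).restrict D).withDensity fun a => ENNReal.ofReal (gaussWeight β H a)))
        (fun a => β * ∑ p ∈ plaquettesTouching (boxEdges 4 (2 * H + 1)), tripleForm (Tc p) (plaqVar H p.1 p.2.1.1 p.2.1.2 a)) 0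
        (linCurvSq H (plaq12At x)) (fun a => chartPlaqCost H y 1 2 a - linCurvSq H (plaq12At y) a)| ≤
      C * B ^ 2 * (H : ℝ) ^ 4 * (1 + Real.log H) ^ 3 / β *
        (Real.sqrt (Real.sqrt (s ^ 6 / β ^ 3 + s ^ 16)) * Real.sqrt (Real.sqrt ((1 + Real.log H) ^ 4 / β ^ 4 + s ^ 6 / β ^ 3))) := by
  obtain ⟨C, hC0, h⟩ := abs_tiltCum4_muSet_rowR2_le
  exact ⟨C, hC0, fun H hH β hβ B Tc hT s hs0 hs1 D hDm hDs τ hτ hτ2 x y =>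
    (abs_add_le _ _).trans (h H hH β hβ B Tc hT s hs0 hs1 D hDm hDs τ hτ hτ2 x y)⟩

/-- ★★ **ROW R2, sum form, β-letters** (`s = β^{−1/2+κ₃}`, `κ₃ ≤ 1/5`, every `β ≥ 1`, `H ≥ 1`):
`|κ₄(Q_x, c_y; P) + κ₄(L_x, Q_y; P)| ≤ C·B²·H⁴·(1+log H)⁴·β^(−7/2 + (3/2)κ₃)`. -/
theorem abs_tiltCum4_muSet_rowR2_sum_le_rpow {κ₃ : ℝ} (hκ5 : κ₃ ≤ 1 / 5) : ∃ C : ℝ, 0 ≤ C ∧ ∀ H : ℕ, 1 ≤ H → ∀ β : ℝ, 1 ≤ β → ∀ B : ℝ,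
    ∀ Tc : ZdPlaquette 4 → Fin 4 → Fin 4 → Fin 4 → ℝ, (∀ p i j k, |Tc p i j k| ≤ B) →
    ∀ D : Set (LandauFree H → E3), MeasurableSet D → D ⊆ smallField H (β ^ (-1 / 2 + κ₃)) →
    ∀ τ : ℝ, gaussAvg β H (fun a => 1 - D.indicator (fun _ => (1 : ℝ)) a) ≤ τ → τ ≤ 1 / 2 → ∀ x y : Site 4,
    |Tilt.tiltCum4 ((((volume : Measure (LandauFree H → E3)).restrict D).withDensity fun a => ENNReal.ofReal (gaussWeight β H a)))
        (fun a => β * ∑ p ∈ plaquettesTouching (boxEdges 4 (2 * H + 1)), tripleForm (Tc p) (plaqVar H p.1 p.2.1.1 p.2.1.2 a)) 0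
        (fun a => chartPlaqCost H x 1 2 a - linCurvSq H (plaq12At x) a) (chartPlaqCost H y 1 2) +
     Tilt.tiltCum4 ((((volume : Measure (LandauFree H → E3)).restrict D).withDensity fun a => ENNReal.ofReal (gaussWeight β H a)))
        (fun a => β * ∑ p ∈ plaquettesTouching (boxEdges 4 (2 * H + 1)), tripleForm (Tc p) (plaqVar H p.1 p.2.1.1 p.2.1.2 a)) 0
        (linCurvSq H (plaq12At x)) (fun a => chartPlaqCost H y 1 2 a - linCurvSq H (plaq12At y) a)| ≤
      C * B ^ 2 * (H : ℝ) ^ 4 * (1 + Real.log H) ^ 4 * β ^ (-7 / 2 + 3 / 2 * κ₃) := by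
  obtain ⟨C, hC0, h⟩ := abs_tiltCum4_muSet_rowR2_le_rpow hκ5
  exact ⟨C, hC0, fun H hH β hβ B Tc hT D hDm hDs τ hτ hτ2 x y =>
    (abs_add_le _ _).trans (h H hH β hβ B Tc hT D hDm hDs τ hτ hτ2 x y)⟩

end GaussNormalForm

end Summit.QuantumFields.YangMills.Theorems.AllWindowsColdBoxBoxHighLine

end
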